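import Summits.KontsevichZagierPeriods.KontsevichZagierPeriods.Theorems.SoloInformedEquidimRelations
import HarnessLib
import HarnessLib.Audit

/-!
# SoloInformed — the flattening operator and the dimension grading (Newton–Leibniz elimination, file 1b-B)

Solo programme `solo-KontsevichZagierPeriods-informed`, session s245 (K-NF file 1b-B of the
kernel programme of THEOREM NF, `paper/nl-elimination.md` §7).

File 583 (`SoloInformedEquidimRelations`) introduced the flattening `r ↦ r × [0,1]`
(`soloInformedFlat`, ONE Newton–Leibniz move) and the flattening span
`U = ⟨[r × [0,1]] − [r]⟩` (`soloInformedFlatSpan`).  Here the flattening is made an operator on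
the free abelian group `FormalRep = ℤ[Σ n, IntegralRep n]` and the dimension grading is set up:

* `soloInformedFlatMap` — `Fl c = c * [[0,1]]`, an additive endomorphism with
  `Fl [r] = [r × [0,1]]`; its powers `soloInformedFlatPow k` and the iterated flattening of a
  representation `soloInformedFlatIter r k : IntegralRep (n + k)`, `Fl^k [r] = [flatIter r k]`;
* **`U = image (Fl − id)`**: `soloInformed_mem_flatSpan_iff : u ∈ U ↔ ∃ y, u = Fl y − y`, and
  `Fl^k c − c ∈ U`;
* the **easy half of the flat-stabilisation criterion** (unconditional):
  `Fl^k c ∈ relations₁₂ → c ∈ relations₁₂ ⊔ U ⊆ relations`, in particular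
  `[flatIter r k] − [flatIter r' k] ∈ relations₁₂ → r ∼ r'`;
* the **dimension grading** `soloInformedDimProj d` (`π_d [r] = [r]` if `dim r = d`, else `0`):
  idempotent, orthogonal, preserving `relations₁₂` (its generators are homogeneous), with
  `π₀ ∘ Fl = 0` and `π_{d+1} ∘ Fl = Fl ∘ π_d`.

The torsion theorem `x ∈ relations₁₂ ⊔ U ↔ (Φ_N x ∈ relations₁₂ for N ≫ 0)` and the kernel
form of COROLLARY NF.1 are in the successor file (1b-C).

References: M. Kontsevich, D. Zagier, *Periods* (2001), §1.2; this work (THEOREM NF and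
COROLLARY NF.1, `paper/nl-elimination.md`).
-/

noncomputable section

open scoped BigOperators

namespace Summit.KontsevichZagierPeriods.KontsevichZagierPeriods.Theorems

open Set MeasureTheory
open Literature.ModelTheory.ExponentialFields
open Literature.NumberTheory.Transcendental Literature.NumberTheory.Transcendental.KZ

variable {n m k d : ℕ}

/-! ### The flattening operator `Fl c = c * [[0,1]]` -/

/-- **The flattening operator** `Fl : FormalRep →+ FormalRep`, `Fl c = c * [[0,1], 1]`
(right multiplication by the unit-interval representation). [this work, THEOREM NF] -/
def soloInformedFlatMap : FormalRep →+ FormalRep :=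
  AddMonoidHom.mulRight (of soloInformedUnitIntervalRep)

/-- `Fl c = c * [[0,1]]`. [this work] -/
theorem soloInformed_flatMap_apply (c : FormalRep) :
    soloInformedFlatMap c = c * of soloInformedUnitIntervalRep := rfl

/-- `Fl [r] = [r × [0,1]]`. [this work] -/
theorem soloInformed_flatMap_of (r : IntegralRep n) :
    soloInformedFlatMap (of r) = of (soloInformedFlat r) := by
  rw [soloInformed_flatMap_apply, soloInformed_of_mul_of_unitIntervalRep]

/-- `Fl c − c ∈ U` for every formal combination `c`. [this work, THEOREM NF] -/
theorem soloInformed_flatMap_sub_self_mem_flatSpan (c : FormalRep) :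
    soloInformedFlatMap c - c ∈ soloInformedFlatSpan := by
  induction c using FreeAbelianGroup.induction_on with
  | zero => rw [map_zero, sub_zero]; exact soloInformedFlatSpan.zero_mem
  | of x =>
    obtain ⟨n, r⟩ := x
    change soloInformedFlatMap (of r) - of r ∈ soloInformedFlatSpan
    rw [soloInformed_flatMap_of]
    exact AddSubgroup.subset_closure ⟨n, r, rfl⟩
  | neg x ih =>
    have : soloInformedFlatMap (-FreeAbelianGroup.of x) - -FreeAbelianGroup.of x =
        -(soloInformedFlatMap (FreeAbelianGroup.of x) - FreeAbelianGroup.of x) := by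
      rw [map_neg]; abel
    rw [this]; exact soloInformedFlatSpan.neg_mem ih
  | add x y hx hy =>
    have : soloInformedFlatMap (x + y) - (x + y) =
        (soloInformedFlatMap x - x) + (soloInformedFlatMap y - y) := by
      rw [map_add]; abel
    rw [this]; exact soloInformedFlatSpan.add_mem hx hy

/-- **`U` is the image of `Fl − id`**: `u ∈ U ↔ ∃ y, u = Fl y − y`. [this work, THEOREM NF] -/
theorem soloInformed_mem_flatSpan_iff (u : FormalRep) :
    u ∈ soloInformedFlatSpan ↔ ∃ y, u = soloInformedFlatMap y - y := by
  constructor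
  · intro hu
    refine AddSubgroup.closure_induction (fun x hx => ?_) ?_ (fun x y _ _ hx hy => ?_)
      (fun x _ hx => ?_) hu
    · obtain ⟨n, r, rfl⟩ := hx
      exact ⟨of r, by rw [soloInformed_flatMap_of]⟩
    · exact ⟨0, by rw [map_zero, sub_zero]⟩
    · obtain ⟨y₁, rfl⟩ := hx
      obtain ⟨y₂, rfl⟩ := hy
      exact ⟨y₁ + y₂, by rw [map_add]; abel⟩
    · obtain ⟨y, rfl⟩ := hx
      exact ⟨-y, by rw [map_neg]; abel⟩
  · rintro ⟨y, rfl⟩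
    exact soloInformed_flatMap_sub_self_mem_flatSpan y

/-- `Fl` preserves `U`. [this work] -/
theorem soloInformed_flatMap_mem_flatSpan {c : FormalRep} (hc : c ∈ soloInformedFlatSpan) :
    soloInformedFlatMap c ∈ soloInformedFlatSpan := by
  have h := soloInformedFlatSpan.add_mem (soloInformed_flatMap_sub_self_mem_flatSpan c) hc
  rwa [sub_add_cancel] at h

/-! ### Powers of `Fl` and iterated flattening of a representation -/

/-- **Powers of the flattening operator**, `Fl^k : FormalRep →+ FormalRep`. [this work] -/
def soloInformedFlatPow : ℕ → (FormalRep →+ FormalRep)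
  | 0 => AddMonoidHom.id FormalRep
  | k + 1 => soloInformedFlatMap.comp (soloInformedFlatPow k)

/-- `Fl^0 c = c`. [this work] -/
@[simp] theorem soloInformed_flatPow_zero_apply (c : FormalRep) : soloInformedFlatPow 0 c = c := rfl

/-- `Fl^(k+1) c = Fl (Fl^k c)`. [this work] -/
theorem soloInformed_flatPow_succ_apply (k : ℕ) (c : FormalRep) :
    soloInformedFlatPow (k + 1) c = soloInformedFlatMap (soloInformedFlatPow k c) := rfl

/-- **Iterated flattening of a representation**: `flatIter r k = r × [0,1]^k : IntegralRep (n + k)`.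
[this work] -/
def soloInformedFlatIter (r : IntegralRep n) : (k : ℕ) → IntegralRep (n + k)
  | 0 => r
  | k + 1 => soloInformedFlat (soloInformedFlatIter r k)

/-- `flatIter r 0 = r`. [this work] -/
@[simp] theorem soloInformed_flatIter_zero (r : IntegralRep n) : soloInformedFlatIter r 0 = r := rfl

/-- `flatIter r (k+1) = flatIter r k × [0,1]`. [this work] -/
theorem soloInformed_flatIter_succ (r : IntegralRep n) (k : ℕ) :
    soloInformedFlatIter r (k + 1) = soloInformedFlat (soloInformedFlatIter r k) := rfl

/-- `Fl^k [r] = [flatIter r k]`. [this work] -/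
theorem soloInformed_flatPow_of (r : IntegralRep n) (k : ℕ) :
    soloInformedFlatPow k (of r) = of (soloInformedFlatIter r k) := by
  induction k with
  | zero => rfl
  | succ k ih => rw [soloInformed_flatPow_succ_apply, ih, soloInformed_flatMap_of]; rfl

/-- The iterated flattening has the same value: `value (flatIter r k) = value r`. [this work] -/
theorem soloInformed_value_flatIter (r : IntegralRep n) (k : ℕ) :
    (soloInformedFlatIter r k).value = r.value := by
  induction k with
  | zero => rfl
  | succ k ih => rw [soloInformed_flatIter_succ, soloInformed_value_flat, ih]

/-- `Fl^k c − c ∈ U`. [this work, THEOREM NF] -/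
theorem soloInformed_flatPow_sub_self_mem_flatSpan (k : ℕ) (c : FormalRep) :
    soloInformedFlatPow k c - c ∈ soloInformedFlatSpan := by
  induction k with
  | zero => rw [soloInformed_flatPow_zero_apply, sub_self]; exact soloInformedFlatSpan.zero_mem
  | succ k ih =>
    have h := soloInformedFlatSpan.add_mem
      (soloInformed_flatMap_sub_self_mem_flatSpan (soloInformedFlatPow k c)) ih
    rwa [sub_add_sub_cancel] at h

/-- `[flatIter r k] − [r] ∈ U ⊆ relations`: the iterated flattening is KZ-equivalent to `r`.
[this work] -/
theorem soloInformed_equivalent_flatIter (r : IntegralRep n) (k : ℕ) :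
    Equivalent (soloInformedFlatIter r k) r := by
  have h := soloInformed_flatPow_sub_self_mem_flatSpan k (of r)
  rw [soloInformed_flatPow_of] at h
  exact soloInformed_flatSpan_le_relations h

/-! ### The easy half of flat-stabilisation (unconditional) -/

/-- **If `Fl^k c ∈ relations₁₂` then `c ∈ relations₁₂ ⊔ U`** (`c = Fl^k c − (Fl^k c − c)`).
[this work, THEOREM NF] -/
theorem soloInformed_mem_sup_of_flatPow_mem (k : ℕ) {c : FormalRep}
    (h : soloInformedFlatPow k c ∈ soloInformedEquidimRelations) :
    c ∈ soloInformedEquidimRelations ⊔ soloInformedFlatSpan := by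
  have h' := (soloInformedEquidimRelations ⊔ soloInformedFlatSpan).sub_mem
    (AddSubgroup.mem_sup_left h)
    (AddSubgroup.mem_sup_right (soloInformed_flatPow_sub_self_mem_flatSpan k c))
  rwa [sub_sub_cancel] at h'

/-- If `Fl^k c ∈ relations₁₂` then `c ∈ relations`. [this work] -/
theorem soloInformed_mem_relations_of_flatPow_mem (k : ℕ) {c : FormalRep}
    (h : soloInformedFlatPow k c ∈ soloInformedEquidimRelations) : c ∈ relations :=
  soloInformed_equidimRelations_sup_flatSpan_le_relations (soloInformed_mem_sup_of_flatPow_mem k h)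

/-- **Equidimensional equivalence after flattening implies KZ-equivalence** (unconditional):
`[flatIter r k] − [flatIter r' k] ∈ relations₁₂ → r ∼ r'`. [this work, COROLLARY NF.1] -/
theorem soloInformed_equivalent_of_flatIter_sub_mem (r : IntegralRep n) (r' : IntegralRep m)
    (k : ℕ) (h : of (soloInformedFlatIter r k) - of (soloInformedFlatIter r' k) ∈
      soloInformedEquidimRelations) : Equivalent r r' := by
  refine soloInformed_mem_relations_of_flatPow_mem k ?_
  rwa [map_sub, soloInformed_flatPow_of, soloInformed_flatPow_of]

/-! ### The dimension grading -/

/-- **The degree-`d` projection** `π_d : FormalRep →+ FormalRep`: `π_d [r] = [r]` if `dim r = d`,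
`0` otherwise (`FormalRep` is graded by the dimension of the generators). [this work] -/
def soloInformedDimProj (d : ℕ) : FormalRep →+ FormalRep :=
  FreeAbelianGroup.lift fun x : (Σ n, IntegralRep n) => if x.1 = d then FreeAbelianGroup.of x else 0

/-- `π_d [r] = if dim r = d then [r] else 0`. [this work] -/
theorem soloInformed_dimProj_of (d : ℕ) (r : IntegralRep n) :
    soloInformedDimProj d (of r) = if n = d then of r else 0 :=
  FreeAbelianGroup.lift_apply_of _ _

/-- `π_n [r] = [r]` for `r` of dimension `n`. [this work] -/
@[simp] theorem soloInformed_dimProj_of_self (r : IntegralRep n) :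
    soloInformedDimProj n (of r) = of r := by
  rw [soloInformed_dimProj_of, if_pos rfl]

/-- `π_d [r] = 0` for `r` of dimension `n ≠ d`. [this work] -/
theorem soloInformed_dimProj_of_ne (h : n ≠ d) (r : IntegralRep n) :
    soloInformedDimProj d (of r) = 0 := by
  rw [soloInformed_dimProj_of, if_neg h]

/-- `π_d ∘ π_d = π_d`. [this work] -/
theorem soloInformed_dimProj_dimProj_self (d : ℕ) (c : FormalRep) :
    soloInformedDimProj d (soloInformedDimProj d c) = soloInformedDimProj d c := by
  induction c using FreeAbelianGroup.induction_on with
  | zero => rw [map_zero, map_zero]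
  | of x =>
    obtain ⟨n, r⟩ := x
    change soloInformedDimProj d (soloInformedDimProj d (of r)) = soloInformedDimProj d (of r)
    by_cases h : n = d
    · subst h; rw [soloInformed_dimProj_of_self, soloInformed_dimProj_of_self]
    · rw [soloInformed_dimProj_of_ne h r, map_zero]
  | neg x ih => rw [map_neg, map_neg, ih]
  | add x y hx hy => rw [map_add, map_add, hx, hy]

/-- `π_d ∘ π_e = 0` for `d ≠ e`. [this work] -/
theorem soloInformed_dimProj_dimProj_of_ne {d e : ℕ} (h : d ≠ e) (c : FormalRep) :
    soloInformedDimProj d (soloInformedDimProj e c) = 0 := by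
  induction c using FreeAbelianGroup.induction_on with
  | zero => rw [map_zero, map_zero]
  | of x =>
    obtain ⟨n, r⟩ := x
    change soloInformedDimProj d (soloInformedDimProj e (of r)) = 0
    by_cases hn : n = e
    · subst hn; rw [soloInformed_dimProj_of_self, soloInformed_dimProj_of_ne (Ne.symm h) r]
    · rw [soloInformed_dimProj_of_ne hn r, map_zero]
  | neg x ih => rw [map_neg, map_neg, ih, neg_zero]
  | add x y hx hy => rw [map_add, map_add, hx, hy, add_zero]

/-- The generators of `relations₁₂` are homogeneous: `π_d` fixes each or kills it. [this work] -/
theorem soloInformed_dimProj_generator {x : FormalRep}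
    (hx : x ∈ domainAddRel ∪ integrandAddRel ∪ changeOfVariablesRel) (d : ℕ) :
    soloInformedDimProj d x = x ∨ soloInformedDimProj d x = 0 := by
  rcases hx with (hx | hx) | hx
  · obtain ⟨n, r, r₁, r₂, -, -, -, -, rfl⟩ := hx
    by_cases h : n = d
    · subst h; left; simp only [map_sub, soloInformed_dimProj_of_self]
    · right
      simp only [map_sub, soloInformed_dimProj_of_ne h, sub_zero]
  · obtain ⟨n, r, r₁, r₂, -, -, -, rfl⟩ := hx
    by_cases h : n = d
    · subst h; left; simp only [map_sub, soloInformed_dimProj_of_self]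
    · right
      simp only [map_sub, soloInformed_dimProj_of_ne h, sub_zero]
  · obtain ⟨n, r, r', -, -, -, -, -, -, -, rfl⟩ := hx
    by_cases h : n = d
    · subst h; left; simp only [map_sub, soloInformed_dimProj_of_self]
    · right
      simp only [map_sub, soloInformed_dimProj_of_ne h, sub_zero]

/-- **`π_d` preserves `relations₁₂`** (the equidimensional relations are a graded subgroup).
[this work, THEOREM NF] -/
theorem soloInformed_dimProj_mem_equidimRelations (d : ℕ) {c : FormalRep}
    (hc : c ∈ soloInformedEquidimRelations) :
    soloInformedDimProj d c ∈ soloInformedEquidimRelations := by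
  refine AddSubgroup.closure_induction (fun x hx => ?_) ?_ (fun x y _ _ hx hy => ?_)
    (fun x _ hx => ?_) hc
  · rcases soloInformed_dimProj_generator hx d with h | h
    · rw [h]; exact AddSubgroup.subset_closure hx
    · rw [h]; exact soloInformedEquidimRelations.zero_mem
  · rw [map_zero]; exact soloInformedEquidimRelations.zero_mem
  · rw [map_add]; exact soloInformedEquidimRelations.add_mem hx hy
  · rw [map_neg]; exact soloInformedEquidimRelations.neg_mem hx

/-- `π₀ ∘ Fl = 0`: a flattened combination has no degree-`0` component. [this work] -/
theorem soloInformed_dimProj_zero_flatMap (c : FormalRep) :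
    soloInformedDimProj 0 (soloInformedFlatMap c) = 0 := by
  induction c using FreeAbelianGroup.induction_on with
  | zero => rw [map_zero, map_zero]
  | of x =>
    obtain ⟨n, r⟩ := x
    change soloInformedDimProj 0 (soloInformedFlatMap (of r)) = 0
    rw [soloInformed_flatMap_of, soloInformed_dimProj_of_ne (Nat.succ_ne_zero n)]
  | neg x ih => rw [map_neg, map_neg, ih, neg_zero]
  | add x y hx hy => rw [map_add, map_add, hx, hy, add_zero]

/-- **`π_{d+1} ∘ Fl = Fl ∘ π_d`**: flattening raises the degree by one. [this work] -/
theorem soloInformed_dimProj_succ_flatMap (d : ℕ) (c : FormalRep) :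
    soloInformedDimProj (d + 1) (soloInformedFlatMap c) =
      soloInformedFlatMap (soloInformedDimProj d c) := by
  induction c using FreeAbelianGroup.induction_on with
  | zero => rw [map_zero, map_zero, map_zero, map_zero]
  | of x =>
    obtain ⟨n, r⟩ := x
    change soloInformedDimProj (d + 1) (soloInformedFlatMap (of r)) =
      soloInformedFlatMap (soloInformedDimProj d (of r))
    by_cases h : n = d
    · subst h
      rw [soloInformed_flatMap_of, soloInformed_dimProj_of_self, soloInformed_dimProj_of_self,
        soloInformed_flatMap_of]
    · rw [soloInformed_flatMap_of, soloInformed_dimProj_of_ne h, map_zero,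
        soloInformed_dimProj_of_ne (show n + 1 ≠ d + 1 by omega)]
  | neg x ih => rw [map_neg, map_neg, map_neg, map_neg, ih]
  | add x y hx hy => rw [map_add, map_add, map_add, map_add, hx, hy]

/-- `π_{d+k} ∘ Fl^k = Fl^k ∘ π_d`. [this work] -/
theorem soloInformed_dimProj_add_flatPow (d k : ℕ) (c : FormalRep) :
    soloInformedDimProj (d + k) (soloInformedFlatPow k c) =
      soloInformedFlatPow k (soloInformedDimProj d c) := by
  induction k with
  | zero => rfl
  | succ k ih =>
    rw [soloInformed_flatPow_succ_apply, soloInformed_flatPow_succ_apply, ← ih]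
    exact soloInformed_dimProj_succ_flatMap (d + k) _

end Summit.KontsevichZagierPeriods.KontsevichZagierPeriods.Theorems
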